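import Literature.Computability.QuantumComplexity.PseudoBounded
import Literature.Computability.QuantumComplexity.AaronsonAmbainis
import HarnessLib

/-!
# Route `SosSandwich`, crux `PseudoBoundedAA` (stmt-QuantumAdvantage-15237) — the SOS-multiplier (tilt) bound on the sandwich class `K_T`

A structural inequality for the SOS sandwich class, `--supports stmt-QuantumAdvantage-15237` (tool for the
T-lossy homogeneous rung `HomogeneousPBAAT` stmt-27399 and for refuters): the "tilted pseudo-expectation"
`Ẽ = E + λ·E[· g]` of the route's conic duality (`PseudoBoundedDual`) made quantitative.  If `g` is a function
on the cube whose action as a MULTIPLIER on squares of degree-`≤ T` polynomials is bounded,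

  `|E[q² g]| ≤ κ · E[q²]` for every real polynomial `q` of total degree `≤ T`,

then for every `p ∈ K_T` (`p = Σ q_j²`, `1 − p = Σ r_j²` on the cube, `deg ≤ T`):

* `abs_boolAvg_mul_le_mul_boolAvg` — `|E[p g]| ≤ κ · E[p]` (sum the hypothesis over the `q_j`);
* `abs_boolAvg_mul_le_mul_one_sub_boolAvg` — if moreover `E[g] = 0`, `|E[p g]| ≤ κ · (1 − E[p])` (use the `r_j`);
* `boolVariance_le_of_multiplier` — taking `g = p − E[p]`: **`Var[p] ≤ κ · min(E[p], 1 − E[p]) ≤ κ/2`**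
  whenever `κ` bounds the degree-`T` multiplier norm of the centred part `p − E[p]`.

So every PB-AA-type statement on `K_T` ("small influences ⟹ small variance") follows from an estimate of the
degree-`T` SOS-multiplier norm `κ_T(p − E p) := sup_{deg q ≤ T} |E[q²(p − E p)]| / E[q²]` by the influences; for
the top-homogeneous class (`p − E p` on Fourier level `2T`) only the level-`T` part of `q` enters `E[q²(p − E p)]`.
Calibration on the address family of `Theorems.SosSandwich.not_HomogeneousPBAA` (`p = ((G+G')/2)²`,
`Var = 1/4`): `q = (G+G')/2` gives `E[q²(p − 1/2)] / E[q²] = 1/2`, so `κ_T ≥ 1/2 = 2·Var` — the bound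
`Var ≤ κ/2` is attained there.  Honest label: a general lemma (finite sums and the two SOS certificates); it
does not bound `κ_T` by influences, which is where the open content of 27399 / PB-AA sits.

Sources: KaniewskiLeeDewolf2015 (arXiv:1411.7280) Thm. 12 (the class); BarakHopkinsKelnerKothariMoitraPotechin2019 (arXiv:1604.03084)
§2 (pseudo-expectations / tilts); AaronsonAmbainis2014 Conj. 6.
-/

-- D-0017: single-conjunct summit ⇒ the duplicate `QuantumAdvantage.QuantumAdvantage` is mandated.
set_option linter.dupNamespace false

noncomputable section

namespace Summit.QuantumAdvantage.QuantumAdvantage.Theorems.SosSandwich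

open Finset MvPolynomial Literature.Computability.QuantumComplexity

namespace MultiplierBound

variable {N : ℕ}

/-- `E[f − h] = E[f] − E[h]` for cube averages. [folklore] -/
theorem boolAvg_sub' (f h : (Fin N → Bool) → ℝ) : boolAvg (fun x => f x - h x) = boolAvg f - boolAvg h := by
  unfold boolAvg
  rw [Finset.sum_sub_distrib, sub_div]

/-- `E[(Σ_j f_j) · g] = Σ_j E[f_j g]` for cube averages. [folklore] -/
theorem boolAvg_sum_mul {m : ℕ} (f : Fin m → (Fin N → Bool) → ℝ) (g : (Fin N → Bool) → ℝ) :
    boolAvg (fun x => (∑ j, f j x) * g x) = ∑ j, boolAvg (fun x => f j x * g x) := by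
  unfold boolAvg
  rw [← Finset.sum_div]
  congr 1
  rw [Finset.sum_comm]
  exact Finset.sum_congr rfl fun x _ => Finset.sum_mul _ _ _

/-- `E[Σ_j f_j] = Σ_j E[f_j]` for cube averages. [folklore] -/
theorem boolAvg_sum {m : ℕ} (f : Fin m → (Fin N → Bool) → ℝ) :
    boolAvg (fun x => ∑ j, f j x) = ∑ j, boolAvg (f j) := by
  unfold boolAvg
  rw [← Finset.sum_div, Finset.sum_comm]

/-- `E[f − c] = E[f] − c`-type linearity: `E[f·g] − c·E[g] = E[(f − c)·g]`. [folklore] -/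
theorem boolAvg_sub_const_mul (f g : (Fin N → Bool) → ℝ) (c : ℝ) :
    boolAvg (fun x => (f x - c) * g x) = boolAvg (fun x => f x * g x) - c * boolAvg g := by
  unfold boolAvg
  rw [mul_div_assoc', ← sub_div, Finset.mul_sum, ← Finset.sum_sub_distrib]
  congr 1
  exact Finset.sum_congr rfl fun x _ => by ring

/-- `E[(1 − f)·g] = E[g] − E[f·g]`. [folklore] -/
theorem boolAvg_one_sub_mul (f g : (Fin N → Bool) → ℝ) :
    boolAvg (fun x => (1 - f x) * g x) = boolAvg g - boolAvg (fun x => f x * g x) := by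
  unfold boolAvg
  rw [← sub_div, ← Finset.sum_sub_distrib]
  congr 1
  exact Finset.sum_congr rfl fun x _ => by ring

/-- `E[1 − f] = 1 − E[f]`. [folklore] -/
theorem boolAvg_one_sub (f : (Fin N → Bool) → ℝ) : boolAvg (fun x => 1 - f x) = 1 - boolAvg f := by
  have h := boolAvg_one_sub_mul f (fun _ => (1 : ℝ))
  simp only [mul_one] at h
  rw [h, boolAvg_const]

end MultiplierBound

open MultiplierBound

variable {N : ℕ}

/-- **SOS-multiplier bound, `q`-side**: if `|E[q² g]| ≤ κ E[q²]` for all `q` of degree `≤ T`, then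
`|E[p g]| ≤ κ E[p]` for every `p ∈ K_T` (write `p = Σ_j q_j²` on the cube and sum).
[cite: BarakHopkinsKelnerKothariMoitraPotechin2019, §2 (pseudo-expectations)] -/
theorem abs_boolAvg_mul_le_mul_boolAvg {T : ℕ} {p : MvPolynomial (Fin N) ℝ} (hp : PseudoBounded T p)
    (g : (Fin N → Bool) → ℝ) {κ : ℝ}
    (hκ : ∀ q : MvPolynomial (Fin N) ℝ, q.totalDegree ≤ T →
      |boolAvg (fun x => evalBool q x ^ 2 * g x)| ≤ κ * boolAvg (fun x => evalBool q x ^ 2)) :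
    |boolAvg (fun x => evalBool p x * g x)| ≤ κ * boolAvg (evalBool p) := by
  obtain ⟨m, q, r, hdeg, hval⟩ := hp
  have hpx : ∀ x, evalBool p x = ∑ j, evalBool (q j) x ^ 2 := fun x => (hval x).1
  have h1 : boolAvg (fun x => evalBool p x * g x) = ∑ j, boolAvg (fun x => evalBool (q j) x ^ 2 * g x) := by
    rw [← boolAvg_sum_mul]
    exact congrArg boolAvg (funext fun x => by rw [hpx x])
  have h2 : boolAvg (evalBool p) = ∑ j, boolAvg (fun x => evalBool (q j) x ^ 2) := by
    rw [← boolAvg_sum]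
    exact congrArg boolAvg (funext fun x => hpx x)
  rw [h1, h2, Finset.mul_sum]
  exact (Finset.abs_sum_le_sum_abs _ _).trans (Finset.sum_le_sum fun j _ => hκ (q j) (hdeg j).1)

/-- **SOS-multiplier bound, `r`-side**: if `|E[q² g]| ≤ κ E[q²]` for all `q` of degree `≤ T` and `E[g] = 0`,
then `|E[p g]| ≤ κ (1 − E[p])` for every `p ∈ K_T` (apply the `q`-side bound to `1 − p = Σ_j r_j²`).
[cite: BarakHopkinsKelnerKothariMoitraPotechin2019, §2 (pseudo-expectations)] -/
theorem abs_boolAvg_mul_le_mul_one_sub_boolAvg {T : ℕ} {p : MvPolynomial (Fin N) ℝ} (hp : PseudoBounded T p)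
    (g : (Fin N → Bool) → ℝ) (hg : boolAvg g = 0) {κ : ℝ}
    (hκ : ∀ q : MvPolynomial (Fin N) ℝ, q.totalDegree ≤ T →
      |boolAvg (fun x => evalBool q x ^ 2 * g x)| ≤ κ * boolAvg (fun x => evalBool q x ^ 2)) :
    |boolAvg (fun x => evalBool p x * g x)| ≤ κ * (1 - boolAvg (evalBool p)) := by
  have h := abs_boolAvg_mul_le_mul_boolAvg hp.one_sub g hκ
  have hev : ∀ x, evalBool (1 - p) x = 1 - evalBool p x := fun x => by
    unfold evalBool; rw [map_sub, map_one]
  have h1 : boolAvg (fun x => evalBool (1 - p) x * g x) = - boolAvg (fun x => evalBool p x * g x) := by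
    rw [show (fun x => evalBool (1 - p) x * g x) = fun x => (1 - evalBool p x) * g x from funext fun x => by rw [hev x],
      boolAvg_one_sub_mul, hg, zero_sub]
  have h2 : boolAvg (evalBool (1 - p)) = 1 - boolAvg (evalBool p) := by
    rw [show evalBool (1 - p) = fun x => 1 - evalBool p x from funext hev, boolAvg_one_sub]
  rw [h1, h2, abs_neg] at h
  exact h

/-- **Variance bound by the multiplier norm of the centred part**: for `p ∈ K_T`, if
`|E[q²·(p − E p)]| ≤ κ·E[q²]` for every `q` of degree `≤ T`, then
`Var[p] ≤ κ·E[p]`, `Var[p] ≤ κ·(1 − E[p])`, hence `Var[p] ≤ κ·min(E p, 1 − E p) ≤ κ/2`.  (The tilted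
functional `E + λE[·(p − E p)]` is a valid degree-`2T` pseudo-expectation for `λ ≤ 1/κ`, and it moves `Ẽ[p]`
by `λ·Var[p]` inside `[0,1]`.)  Equality case: the address family of `not_HomogeneousPBAA` has `Var = 1/4`,
`κ_T ≥ 1/2`. [cite: BarakHopkinsKelnerKothariMoitraPotechin2019, §2 (pseudo-expectations)] [cite: AaronsonAmbainis2014, Conj. 6] -/
theorem boolVariance_le_of_multiplier {T : ℕ} {p : MvPolynomial (Fin N) ℝ} (hp : PseudoBounded T p) {κ : ℝ}
    (hκ : ∀ q : MvPolynomial (Fin N) ℝ, q.totalDegree ≤ T →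
      |boolAvg (fun x => evalBool q x ^ 2 * (evalBool p x - boolAvg (evalBool p)))| ≤
        κ * boolAvg (fun x => evalBool q x ^ 2)) :
    boolVariance p ≤ κ * min (boolAvg (evalBool p)) (1 - boolAvg (evalBool p)) := by
  set μ := boolAvg (evalBool p) with hμ
  set g : (Fin N → Bool) → ℝ := fun x => evalBool p x - μ with hg
  have hg0 : boolAvg g = 0 := by
    rw [hg, boolAvg_sub' (evalBool p) (fun _ => μ), boolAvg_const, hμ, sub_self]
  -- `Var[p] = E[p · (p − μ)]`
  have hvar : boolVariance p = boolAvg (fun x => evalBool p x * g x) := by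
    have h := boolAvg_sub_const_mul (evalBool p) g μ
    rw [hg0, mul_zero, sub_zero] at h
    rw [← h]
    unfold boolVariance
    exact congrArg boolAvg (funext fun x => by rw [hg, sq])
  have hq := abs_boolAvg_mul_le_mul_boolAvg hp g hκ
  have hr := abs_boolAvg_mul_le_mul_one_sub_boolAvg hp g hg0 hκ
  rw [← hvar] at hq hr
  have hv := le_abs_self (boolVariance p)
  rcases le_total μ (1 - μ) with hle | hle
  · rw [min_eq_left hle]; linarith
  · rw [min_eq_right hle]; linarith

/-- The same with the cruder constant: `Var[p] ≤ κ/2`. [cite: BarakHopkinsKelnerKothariMoitraPotechin2019, §2 (pseudo-expectations)] -/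
theorem boolVariance_le_half_multiplier {T : ℕ} {p : MvPolynomial (Fin N) ℝ} (hp : PseudoBounded T p)
    {κ : ℝ} (hκ0 : 0 ≤ κ)
    (hκ : ∀ q : MvPolynomial (Fin N) ℝ, q.totalDegree ≤ T →
      |boolAvg (fun x => evalBool q x ^ 2 * (evalBool p x - boolAvg (evalBool p)))| ≤
        κ * boolAvg (fun x => evalBool q x ^ 2)) :
    boolVariance p ≤ κ / 2 := by
  have h := boolVariance_le_of_multiplier hp hκ
  have hmin : min (boolAvg (evalBool p)) (1 - boolAvg (evalBool p)) ≤ 1 / 2 := by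
    rcases le_total (boolAvg (evalBool p)) (1 / 2) with h1 | h1
    · exact (min_le_left _ _).trans h1
    · exact (min_le_right _ _).trans (by linarith)
  calc boolVariance p ≤ κ * min (boolAvg (evalBool p)) (1 - boolAvg (evalBool p)) := h
    _ ≤ κ * (1 / 2) := mul_le_mul_of_nonneg_left hmin hκ0
    _ = κ / 2 := by ring

/-- **Contrapositive, the form a proof of the rung would use**: for `p ∈ K_T` with `Var[p] ≥ ε > 0` there is a
degree-`≤ T` test polynomial `q` on which the centred part acts as a large multiplier,
`|E[q²(p − E p)]| > (ε · E[q²])`-scale — precisely, the multiplier bound fails for every `κ < 2ε`.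
[cite: BarakHopkinsKelnerKothariMoitraPotechin2019, §2 (pseudo-expectations)] -/
theorem exists_multiplier_witness {T : ℕ} {p : MvPolynomial (Fin N) ℝ} (hp : PseudoBounded T p) {ε κ : ℝ}
    (hv : ε ≤ boolVariance p) (hκ0 : 0 ≤ κ) (hκ : κ < 2 * ε) :
    ∃ q : MvPolynomial (Fin N) ℝ, q.totalDegree ≤ T ∧
      κ * boolAvg (fun x => evalBool q x ^ 2) <
        |boolAvg (fun x => evalBool q x ^ 2 * (evalBool p x - boolAvg (evalBool p)))| := by
  by_contra hcon
  push Not at hcon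
  have h := boolVariance_le_half_multiplier hp hκ0 hcon
  linarith

end Summit.QuantumAdvantage.QuantumAdvantage.Theorems.SosSandwich

end
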